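/-
Copyright (c) 2026 the pub-hodgecm-mathlib formalisation cell (harness21).  Prover seat hodgecm-mathlib-K2E3-p14 (g9) (E3 hand on strike line L1; U1 stage-3 plan of record
M-158q (4); LEAD F0P6-plan (g14) BATCH #121 (2) seam (Q-P), road (i) «pole-set-pinned sibling»), Track B «K2-LIT» ∕ hLiu418 = stmt-HodgeConjecture-24832: THE READING LEMMA
«at the `P = {½}`-pinned continuation the value `Es(½)` IS the canonical residue `resGen`» — so U1-glob's `resGen = 0` is the letter `hEs½` of ★ `K2LiuResidueZeroRemovable`.
THEOREMS ONLY.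
-/
import Summits.HodgeConjecture.HodgeConjecture.Theorems.K2LiuFirstTermResidueGenDefs   -- ★ U0 (K2Liu-p08 (g0)): `resGen`, `tendsto_resGen`; brings ★ `continuousAt_half_of_differentiableOn`
import HarnessLib

/-!
# Crux `HLiu418`, organ U1-CT-ind STAGE 3 («U1-glob») ∕ seam (Q-P): THE VALUE AT `½` OF A `P = {½}`-PINNED CONTINUATION IS `resGen`
# «`Es s h = (s − ½)·E^Δ(s; f_s)(h)` on `{n∕2 < re}`, `Es · h` holomorphic on `{0 < re}` ⇒ `Es ½ h = resGen hex h`; hence `resGen hex = 0 ⇒ Es ½ · = 0`»   [KudlaRallis1994 §1 Thm. 1.1]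

Cell `hodgecm-mathlib`, crux item hLiu418 = `stmt-HodgeConjecture-24832`; squad K2, strike line L1, LEAD F0P6-plan (g14); prover K2E3-p14 (g9) (U1 stage-3 lead).  Lane
`--supports stmt-HodgeConjecture-24832 --as helper` (count-neutral).  THEOREMS ONLY (no `def`, no `instance`, no notation, no named-fact hypothesis, no `sorry`).  GENERIC in the
doubled datum `(e, dV, dW)`, the rank `n` and the family `f`.

THE POINT (BATCH #121 (2), road (i)).  HOL-½′ (FACE-A's residue of record, M-158t) is paid by ★ `K2LiuResidueZeroRemovable.exists_continuation_of_eq_prod_singleton_mul` from a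
continuation `Es` PINNED at `P = {½}` — (i) holomorphic on `{0 < re}`, (iv) `Es s h = (∏_{p∈{½}}(s − p))·E^Δ(s; f_s)(h)` on `{n∕2 < re}` — and the vanishing letter `hEs½ : Es ½ · = 0`.
U1-glob's END head delivers `resGen hex = 0` (★ U0's canonical residue, choice-free).  THIS FILE is the bridge: along the pinned pair the pole-clearing quotient is `Es s h ∕ (s − ½)`, so
`(s − ½)·(Es s h ∕ ∏_{p∈{½}}(s − p)) = Es s h` off `½`, whose limit at `½` is `Es ½ h` by continuity ((i)) and `resGen hex h` by ★ `tendsto_resGen`; limits along `𝓝[≠] ½` are unique.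
* `mul_div_prod_singleton_eq` (the algebra off `½`);
* **`es_half_eq_resGen`** — `Es (1∕2) h = resGen hex h` for every `P = {½}`-pinned continuation;
* **`es_half_eq_zero_of_resGen_eq_zero`** — hence `resGen hex = 0 → ∀ h, Es (1∕2) h = 0` (= `hEs½`).
References: [KudlaRallis1994] S. Kudla, S. Rallis, Ann. of Math. 140 (1994), §1 Thm. 1.1; [Liu2021] Y. Liu, Invent. Math. (2021), App. B Lem. B.12 pp. 103–104;
[MoeglinWaldspurger1995] C. Mœglin, J.-L. Waldspurger, CUP (1995), IV.1.9–IV.1.11.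
HONEST LABEL.  Count-neutral helper: `HC_CM` is proved only modulo the 7 printed citations (2 remaining named inputs: hLiu418 = `stmt-HodgeConjecture-24832`,
h413 = `stmt-HodgeConjecture-24833`) until rung 0 closes.
-/

set_option autoImplicit false
set_option linter.dupNamespace false -- the mandated namespace repeats `HodgeConjecture.HodgeConjecture`

noncomputable section

open scoped Topology BigOperators
open Filter NumberField IsDedekindDomain
open Literature.NumberTheory.Automorphic Literature.NumberTheory.GaloisRepresentations
open Literature.NumberTheory.GelbartRogawski1991 Literature.NumberTheory.GelbartRogawski1991.GRConstruction
open Literature.NumberTheory.K2Lit.SiegelDoubled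

namespace Summit.HodgeConjecture.HodgeConjecture.Cruxes.HLiu418.K2LiuResGenHalfValue

open Summit.HodgeConjecture.HodgeConjecture.Cruxes.HLiu418.K2LiuFirstTermResidueFormDefs
open Summit.HodgeConjecture.HodgeConjecture.Cruxes.HLiu418.K2LiuFirstTermResidueForm (continuousAt_half_of_differentiableOn)
open Summit.HodgeConjecture.HodgeConjecture.Cruxes.HLiu418.K2LiuFirstTermResidueGenDefs

/-! ## §1 The algebra of the singleton pole set off `½` -/

/-- off `½`: `(s − ½)·(z ∕ ∏_{p∈{½}}(s − p)) = z` (`∏_{p∈{½}}(s − p) = s − ½`, ★ `K2LiuSiegelEisensteinBigCellTermPackageCM.prod_singleton_half` ∕ `Finset.prod_singleton`). [folklore] -/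
theorem mul_div_prod_singleton_eq {s : ℂ} (hs : s ≠ 1 / 2) (z : ℂ) :
    (s - 1 / 2) * (z / ∏ p ∈ ({(1 / 2 : ℂ)} : Finset ℂ), (s - p)) = z := by
  rw [Finset.prod_singleton, mul_div_cancel₀ z (sub_ne_zero.2 hs)]

/-! ## §2 The value at `½` of a `P = {½}`-pinned continuation is `resGen` -/

variable {L : Type} [Field L] [NumberField L] [IsCMField L]
variable {N M n : ℕ} {e : Fin N × Fin M ≃ Fin n}
  {dV : Fin N → L} {hdV : ∀ i, IsCMField.complexConj L (dV i) = dV i}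
  {dW : Fin M → L} {hdW : ∀ i, IsCMField.complexConj L (dW i) = dW i}
  {f : ℂ → HA L e dV hdV dW hdW → ℂ}

/-- **`Es ½ h = resGen hex h` FOR A `P = {½}`-PINNED CONTINUATION.**  `Es · h` holomorphic on `{0 < re}` (#41 (i)) and `Es s h = (∏_{p∈{½}}(s − p))·E^Δ(s; f_s)(h)` on `{n∕2 < re}`
(#41 (iv) at `P = {½}`): off `½` the cleared quotient times `(s − ½)` is `Es s h` itself, its limit at `½` is `Es ½ h` (continuity) and `resGen hex h` (★ `tendsto_resGen`).
[cite: KudlaRallis1994, §1 Thm. 1.1] [cite: Liu2021, Lem. B.12 pp. 103–104] -/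
theorem es_half_eq_resGen
    (hex : ∃ (P : Finset ℂ) (Es : ℂ → HA L e dV hdV dW hdW → ℂ),
      (∀ h : HA L e dV hdV dW hdW, DifferentiableOn ℂ (fun s => Es s h) {s : ℂ | 0 < s.re}) ∧
      (∀ s : ℂ, 0 < s.re → Continuous (Es s)) ∧
      (∀ s : ℂ, 0 < s.re → ∀ (γ : ratH L e dV hdV dW hdW) (h : HA L e dV hdV dW hdW),
        Es s ((γ : HA L e dV hdV dW hdW) * h) = Es s h) ∧
      (∀ (s : ℂ) (h : HA L e dV hdV dW hdW), (n : ℝ) / 2 < s.re →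
        Es s h = (∏ p ∈ P, (s - p)) * eisensteinFamilyDelta L e dV hdV dW hdW f s h) ∧
      (∀ z : ℂ, 0 < z.re → ∃ C A r : ℝ, 0 < r ∧ ∀ s : ℂ, dist s z < r → ∀ h : HA L e dV hdV dW hdW,
        ‖Es s h‖ ≤ C * adelicHeightGL (n + n) L (h : GL (Fin (n + n)) (AdeleRing (𝓞 L) L)) ^ A))
    (Es : ℂ → HA L e dV hdV dW hdW → ℂ)
    (hd : ∀ h : HA L e dV hdV dW hdW, DifferentiableOn ℂ (fun s => Es s h) {s : ℂ | 0 < s.re})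
    (hiv : ∀ (s : ℂ) (h : HA L e dV hdV dW hdW), (n : ℝ) / 2 < s.re →
      Es s h = (∏ p ∈ ({(1 / 2 : ℂ)} : Finset ℂ), (s - p)) * eisensteinFamilyDelta L e dV hdV dW hdW f s h)
    (h : HA L e dV hdV dW hdW) :
    Es (1 / 2) h = resGen hex h := by
  -- the cleared quotient times `(s − ½)` is `Es s h` off `½`; both limits along `𝓝[≠] ½`
  have hres := tendsto_resGen hex {(1 / 2 : ℂ)} Es hd hiv h
  have hcont : Tendsto (fun s : ℂ => Es s h) (𝓝[≠] (1 / 2)) (𝓝 (Es (1 / 2) h)) :=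
    (continuousAt_half_of_differentiableOn hd h).tendsto.mono_left nhdsWithin_le_nhds
  have hcongr : Tendsto (fun s : ℂ => Es s h) (𝓝[≠] (1 / 2)) (𝓝 (resGen hex h)) := by
    refine hres.congr' ?_
    filter_upwards [self_mem_nhdsWithin] with s hs
    exact mul_div_prod_singleton_eq hs (Es s h)
  exact tendsto_nhds_unique hcont hcongr

/-- **`resGen = 0 ⇒ Es ½ · = 0` AT THE PINNED CONTINUATION** — the letter `hEs½` of ★ `K2LiuResidueZeroRemovable.exists_continuation_of_eq_prod_singleton_mul` (HOL-½′'s payer) from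
U1-glob's END head. [cite: KudlaRallis1994, §1 Thm. 1.1] [cite: MoeglinWaldspurger1995, IV.1.9–IV.1.11] -/
theorem es_half_eq_zero_of_resGen_eq_zero
    (hex : ∃ (P : Finset ℂ) (Es : ℂ → HA L e dV hdV dW hdW → ℂ),
      (∀ h : HA L e dV hdV dW hdW, DifferentiableOn ℂ (fun s => Es s h) {s : ℂ | 0 < s.re}) ∧
      (∀ s : ℂ, 0 < s.re → Continuous (Es s)) ∧
      (∀ s : ℂ, 0 < s.re → ∀ (γ : ratH L e dV hdV dW hdW) (h : HA L e dV hdV dW hdW),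
        Es s ((γ : HA L e dV hdV dW hdW) * h) = Es s h) ∧
      (∀ (s : ℂ) (h : HA L e dV hdV dW hdW), (n : ℝ) / 2 < s.re →
        Es s h = (∏ p ∈ P, (s - p)) * eisensteinFamilyDelta L e dV hdV dW hdW f s h) ∧
      (∀ z : ℂ, 0 < z.re → ∃ C A r : ℝ, 0 < r ∧ ∀ s : ℂ, dist s z < r → ∀ h : HA L e dV hdV dW hdW,
        ‖Es s h‖ ≤ C * adelicHeightGL (n + n) L (h : GL (Fin (n + n)) (AdeleRing (𝓞 L) L)) ^ A))
    (Es : ℂ → HA L e dV hdV dW hdW → ℂ)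
    (hd : ∀ h : HA L e dV hdV dW hdW, DifferentiableOn ℂ (fun s => Es s h) {s : ℂ | 0 < s.re})
    (hiv : ∀ (s : ℂ) (h : HA L e dV hdV dW hdW), (n : ℝ) / 2 < s.re →
      Es s h = (∏ p ∈ ({(1 / 2 : ℂ)} : Finset ℂ), (s - p)) * eisensteinFamilyDelta L e dV hdV dW hdW f s h)
    (h0 : resGen hex = 0) (h : HA L e dV hdV dW hdW) :
    Es (1 / 2) h = 0 := by
  rw [es_half_eq_resGen hex Es hd hiv h, h0, Pi.zero_apply]

end Summit.HodgeConjecture.HodgeConjecture.Cruxes.HLiu418.K2LiuResGenHalfValue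

end
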